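import Summits.ResolutionOfSingularities.ResolutionOfSingularities.Theorems.RadicialJungCleanModelsSufficeGameDefs
import Summits.ResolutionOfSingularities.ResolutionOfSingularities.Theorems.RadicialJungCleanModelsSufficeThreshold
import Summits.ResolutionOfSingularities.ResolutionOfSingularities.Theorems.RadicialJungCleanModelsSufficeThresholdTwoLe
import Summits.ResolutionOfSingularities.ResolutionOfSingularities.Theorems.RadicialJungCleanModelsSufficeSingClosed
import Summits.ResolutionOfSingularities.ResolutionOfSingularities.Theorems.PAlterationPicoverTowerTransport
import Literature.AlgebraicGeometry.Resolution.PthRootIntegralClosureLocal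
import Literature.AlgebraicGeometry.Resolution.StalkSpecializesLocalization
import Literature.AlgebraicGeometry.Resolution.GermsOfClosedSubsets

/-!
# Route `RadicialJung`, crux `CleanModelsSuffice`, line `Sketch`: the exceptionalisation game —
# the normalisation-singular locus `S₂` and its germs, read off a game state

Helper for the registered stubs `stub_gameCentre1` / `stub_gameCentre2` of the skeleton of
`Summit.ResolutionOfSingularities.ResolutionOfSingularities.Theses.RadicialJung.CleanModelsSuffice`
(stmt-ResolutionOfSingularities-15883). For a game state `S` on the model `π : V → V₀` and ANY
`K(V)`-algebra structure on `L` compatible with `π^♯ : K(V₀) → K(V)` (in the application the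
transport along the birational `π`), with `S₂ := {w | integralClosure 𝒪_{V,w} L is not regular}`:

* `GameState.y_pow_algebraMap` — the radicand equation `y_v^p = w_v ∏ u_{v,i}^{a_{v,i}}` in `L`;
* `GameState.isLocalRing_integralClosure_stalk_of_gameState` (every `integralClosure 𝒪_{V,w} L` is local,
  `isLocalRing_integralClosure_of_pth_root`) and `GameState.isClosed_singTwo` (`S₂` is closed,
  `isClosed_setOf_not_isRegularLocalRing_integralClosure`);
* `GameState.not_isRegularLocalRing_iff_two_le_card_ch` — **(B') `w ∈ S₂ ⟺ |ch w| ≥ 2`**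
  (own data of `w`: threshold lemmas with `O = 𝒪_{V,w}`; the regular-type case from the REG
  clause, `CleanResolves.isRegularLocalRing_integralClosure_of_wound/_of_transversal`);
* `GameState.not_isRegularLocalRing_fromSpecStalk_iff` — **(B) for a generisation `η_𝔮` of `v`
  (`𝔮 ∈ Spec 𝒪_{V,v}`, `v` with a charged coordinate): `η_𝔮 ∈ S₂ ⟺` two distinct charged
  coordinates of `v` lie in `𝔮`** (threshold lemmas with `O = 𝒪_{V,η_𝔮} = (𝒪_{V,v})_𝔮`,
  `isLocalizationAtPrime_stalkSpecializes`).
-/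

noncomputable section

set_option linter.dupNamespace false -- mandated namespace of this single-conjunct summit

open CategoryTheory AlgebraicGeometry TopologicalSpace IsLocalRing
open Literature.AlgebraicGeometry.Resolution Literature.AlgebraicGeometry.Motives
open Summit.ResolutionOfSingularities.ResolutionOfSingularities.Theorems.Picover

namespace Summit.ResolutionOfSingularities.ResolutionOfSingularities.Theorems.RadicialJung.CleanModelsSuffice

attribute [local instance] stalkAlgebra isScalarTower_stalkAlgebra

namespace GameState

variable {p : ℕ} {V₀ : Scheme.{0}} [IsIntegral V₀] {L : Type} [Field L] [Algebra V₀.functionField L]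
  {V : Scheme.{0}} [IsIntegral V] {π : V ⟶ V₀} [IsDominant π]
  [Algebra V.functionField L] (S : GameState p V₀ L V π)

/-! ## The radicand equation in a compatible `K(V)`-algebra structure -/

section Radicand

variable (hrange : Set.range (algebraMap V.functionField L) = Set.range (algebraMap V₀.functionField L))
  (hcompat : ∀ g : V₀.functionField,
    algebraMap V.functionField L (RatFn.functionFieldMap π g) = algebraMap V₀.functionField L g)

include hrange in
/-- The generator `y_v` is not in `K(V)`. [folklore] -/
theorem y_not_mem_range_of_range_eq (v : V) : S.y v ∉ Set.range (algebraMap V.functionField L) := by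
  rw [hrange]
  exact S.y_not_mem v

include hcompat in
/-- **The radicand equation** `y_v^p = w_v · ∏ᵢ u_{v,i}^{a_{v,i}}` in `L` (through
`𝒪_{V,v} → K(V) → L`). [folklore] -/
theorem y_pow_algebraMap (v : V) :
    S.y v ^ p = algebraMap (V.presheaf.stalk v) L (S.w v * ∏ i, S.u v i ^ S.a v i) := by
  rw [← S.y_pow v, ← hcompat, S.map_g v, ← IsScalarTower.algebraMap_apply]

end Radicand

/-! ## Algebra structures on stalks: over the ground field, and at a generisation -/

section Stalks

omit [IsIntegral V] in
/-- The local rings of `V` are essentially of finite type over the ground field `k` (for some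
`k`-algebra structure), when `V → Spec k` is locally of finite type. [folklore] -/
theorem exists_algebra_essFiniteType (k : Type) [Field k] (f : V ⟶ Spec (.of k))
    [LocallyOfFiniteType f] (x : V) :
    ∃ _ : Algebra k (V.presheaf.stalk x), Algebra.EssFiniteType k (V.presheaf.stalk x) := by
  -- adapted from `smooth_of_isRegular_of_perfectField` (`SmoothOfRegularPerfectField.lean`)
  let R := (Spec (CommRingCat.of k)).presheaf.stalk (f x)
  letI algRS : Algebra R (V.presheaf.stalk x) := (f.stalkMap x).hom.toAlgebra
  letI algkR : Algebra k R := StructureSheaf.stalkAlgebra (↑(CommRingCat.of k)) (f x)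
  haveI : IsLocalization.AtPrime R (f x).asIdeal :=
    StructureSheaf.IsLocalization.to_stalk (↑(CommRingCat.of k)) (f x)
  haveI : Algebra.EssFiniteType k R := Algebra.EssFiniteType.of_isLocalization R (f x).asIdeal.primeCompl
  letI algkS : Algebra k (V.presheaf.stalk x) := ((algebraMap R _).comp (algebraMap k R)).toAlgebra
  haveI : IsScalarTower k R (V.presheaf.stalk x) := IsScalarTower.of_algebraMap_eq' rfl
  haveI : Algebra.EssFiniteType R (V.presheaf.stalk x) := LocallyOfFiniteType.stalkMap f x
  exact ⟨algkS, Algebra.EssFiniteType.comp k R _⟩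

/-- A local ring is its own localisation at the maximal ideal. [folklore] -/
theorem isLocalization_atPrime_maximalIdeal_self (A : Type) [CommRing A] [IsLocalRing A] :
    IsLocalization.AtPrime A (maximalIdeal A) :=
  IsLocalization.of_le_isUnit fun x hx => not_not.mp fun h =>
    hx ((mem_maximalIdeal x).mpr (mem_nonunits_iff.mpr h))

variable (v : V) (q : PrimeSpectrum (V.presheaf.stalk v))

omit [IsIntegral V] in
/-- `𝒪_{V,η_𝔮} = (𝒪_{V,v})_𝔮`, for the generisation `η_𝔮` of `v` defined by `𝔮 ∈ Spec 𝒪_{V,v}`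
and the `𝒪_{V,v}`-algebra structure on `𝒪_{V,η_𝔮}` given by the specialisation map. [folklore] -/
theorem isLocalization_generisation :
    letI := (V.presheaf.stalkSpecializes (fromSpecStalk_specializes q)).hom.toAlgebra
    IsLocalization.AtPrime (V.presheaf.stalk (V.fromSpecStalk v q)) q.asIdeal := by
  letI := (V.presheaf.stalkSpecializes (fromSpecStalk_specializes q)).hom.toAlgebra
  have h := Literature.AlgebraicGeometry.Resolution.isLocalizationAtPrime_stalkSpecializes (X := V)
    (fromSpecStalk_specializes q)
  have h2 : (maximalIdeal _).comap (V.presheaf.stalkSpecializes (fromSpecStalk_specializes q)).hom =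
      q.asIdeal := primeOfSpecializes_fromSpecStalk q
  have h3 : ((maximalIdeal _).comap
      (V.presheaf.stalkSpecializes (fromSpecStalk_specializes q)).hom).primeCompl =
      q.asIdeal.primeCompl := by
    ext x
    change x ∉ _ ↔ x ∉ _
    rw [h2]
  unfold IsLocalization.AtPrime at h ⊢
  rwa [h3] at h

/-- `𝒪_{V,v} → 𝒪_{V,η_𝔮} → K(V)` is a scalar tower (both maps are specialisation maps).
[folklore] -/
theorem isScalarTower_generisation_functionField :
    letI := (V.presheaf.stalkSpecializes (fromSpecStalk_specializes q)).hom.toAlgebra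
    IsScalarTower (V.presheaf.stalk v) (V.presheaf.stalk (V.fromSpecStalk v q)) V.functionField := by
  letI := (V.presheaf.stalkSpecializes (fromSpecStalk_specializes q)).hom.toAlgebra
  refine IsScalarTower.of_algebraMap_eq' ?_
  change (V.presheaf.stalkSpecializes _).hom =
    (V.presheaf.stalkSpecializes _).hom.comp (V.presheaf.stalkSpecializes _).hom
  rw [← CommRingCat.hom_comp, TopCat.Presheaf.stalkSpecializes_comp]

/-- `𝒪_{V,v} → 𝒪_{V,η_𝔮} → L` is a scalar tower. [folklore] -/
theorem isScalarTower_generisation :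
    letI := (V.presheaf.stalkSpecializes (fromSpecStalk_specializes q)).hom.toAlgebra
    IsScalarTower (V.presheaf.stalk v) (V.presheaf.stalk (V.fromSpecStalk v q)) L := by
  letI := (V.presheaf.stalkSpecializes (fromSpecStalk_specializes q)).hom.toAlgebra
  haveI := isScalarTower_generisation_functionField v q
  refine IsScalarTower.of_algebraMap_eq fun x => ?_
  rw [IsScalarTower.algebraMap_apply (V.presheaf.stalk (V.fromSpecStalk v q)) V.functionField L,
    ← IsScalarTower.algebraMap_apply (V.presheaf.stalk v) (V.presheaf.stalk (V.fromSpecStalk v q))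
      V.functionField,
    ← IsScalarTower.algebraMap_apply]

end Stalks

/-! ## Every `integralClosure 𝒪_{V,w} L` is local; `S₂` is closed; the thresholds -/

section Thresholds

variable (hp : p.Prime) (k : Type) [Field k] [CharP k p] (f : V ⟶ Spec (.of k))
  (hdegV : Module.finrank V.functionField L = p)
  (hrange : Set.range (algebraMap V.functionField L) = Set.range (algebraMap V₀.functionField L))
  (hcompat : ∀ g : V₀.functionField,
    algebraMap V.functionField L (RatFn.functionFieldMap π g) = algebraMap V₀.functionField L g)

include S hdegV hrange hcompat in
/-- Every `integralClosure 𝒪_{V,w} L` is a local ring (`L = K(V)(y_w)`, `y_w^p ∈ K(V)`, and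
`𝒪_{V,w}` is regular, hence integrally closed: `isLocalRing_integralClosure_of_pth_root`).
[folklore] -/
theorem isLocalRing_integralClosure_stalk_of_gameState (hp : p.Prime) (k : Type) [Field k] [CharP k p]
    (f : V ⟶ Spec (.of k)) (w : V) : IsLocalRing (integralClosure (V.presheaf.stalk w) L) := by
  haveI : CharP V.functionField p := TowerTransport.charP_functionField V f
  haveI : IsRegularLocalRing (V.presheaf.stalk w) := S.isRegular w
  haveI : IsIntegrallyClosed (V.presheaf.stalk w) := isIntegrallyClosed_of_isRegularLocalRing _
  have hyp : S.y w ^ p = algebraMap V.functionField L (RatFn.functionFieldMap π (S.g w)) := by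
    rw [hcompat, S.y_pow w]
  exact isLocalRing_integralClosure_of_pth_root (O := V.presheaf.stalk w) hp hdegV _ (S.y w)
    (S.y_not_mem_range_of_range_eq hrange w) hyp

include S hp f hdegV hrange hcompat in
/-- **`S₂ = {w | integralClosure 𝒪_{V,w} L is not regular}` is closed** (image of the singular
locus of `V^L`, `isClosed_setOf_not_isRegularLocalRing_integralClosure`). [folklore] -/
theorem isClosed_singTwo [LocallyOfFiniteType f] :
    IsClosed {w : V | ¬ IsRegularLocalRing (integralClosure (V.presheaf.stalk w) L)} :=
  isClosed_setOf_not_isRegularLocalRing_integralClosure p hp k V f L hdegV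
    (S.isLocalRing_integralClosure_stalk_of_gameState hdegV hrange hcompat hp k f)

include hp f hdegV hrange hcompat in
/-- **(B') The normalisation is singular over `w` iff at least two coordinates are charged at
`w`.** (Own data of `w`, threshold lemmas with `O = 𝒪_{V,w}`; if no coordinate is charged, the
REG clause makes the integral closure regular,
`CleanResolves.isRegularLocalRing_integralClosure_of_wound/_of_transversal`.) [folklore] -/
theorem not_isRegularLocalRing_iff_two_le_card_ch [LocallyOfFiniteType f] (w : V) :
    ¬ IsRegularLocalRing (integralClosure (V.presheaf.stalk w) L) ↔ 2 ≤ (S.ch w).card := by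
  classical
  haveI : CharP V.functionField p := TowerTransport.charP_functionField V f
  haveI : IsRegularLocalRing (V.presheaf.stalk w) := S.isRegular w
  haveI := isLocalization_atPrime_maximalIdeal_self (V.presheaf.stalk w)
  obtain ⟨algk, hess⟩ := exists_algebra_essFiniteType k f w
  have humem : ∀ i, S.u w i ∈ maximalIdeal (V.presheaf.stalk w) := fun i =>
    S.span_u w ▸ Ideal.subset_span ⟨i, rfl⟩
  have hmemch : ∀ i, i ∈ S.ch w ↔ S.a w i ≠ 0 := fun i => by simp [GameState.ch]
  constructor
  · intro hnot
    by_contra hlt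
    apply hnot
    have hle : (S.ch w).card ≤ 1 := by omega
    by_cases hch : ∃ i, S.a w i ≠ 0
    · exact isRegularLocalRing_integralClosure_of_charged_le_one (A := V.presheaf.stalk w)
        (O := V.presheaf.stalk w) (K := V.functionField) (maximalIdeal _) p hp hdegV k (S.u w)
        (S.spanFinrank_eq w) (S.span_u w) (S.a w) (S.a_spec w) (S.w w) (S.isUnit_w w) (S.y w)
        (S.y_not_mem_range_of_range_eq hrange w) (S.y_pow_algebraMap hcompat w) hch
        fun i j hi hj _ _ => Finset.card_le_one.mp hle i ((hmemch i).mpr hi) j ((hmemch j).mpr hj)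
    · -- regular type: the REG clause
      push Not at hch
      haveI : CharP (V.presheaf.stalk w) p :=
        RingHom.charP (algebraMap (V.presheaf.stalk w) V.functionField) (IsFractionRing.injective _ _) p
      haveI : CharP L p := charP_of_injective_ringHom (algebraMap V.functionField L).injective p
      haveI : FiniteDimensional V.functionField L :=
        Module.finite_of_finrank_pos (by rw [hdegV]; exact hp.pos)
      have hyp : S.y w ^ p = algebraMap (V.presheaf.stalk w) L (S.w w) := by
        rw [S.y_pow_algebraMap hcompat w]
        congr 1
        rw [Finset.prod_eq_one fun i _ => by rw [hch i, pow_zero], mul_one]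
      rcases S.reg w hch with hwound | ⟨x, hx1, hx2⟩
      · exact CleanResolves.isRegularLocalRing_integralClosure_of_wound (K := V.functionField) hp hdegV
          (S.w w) (S.y w) (S.y_not_mem_range_of_range_eq hrange w) hyp hwound
      · exact CleanResolves.isRegularLocalRing_integralClosure_of_transversal (K := V.functionField)
          hp hdegV (S.w w) (S.y w) (S.y_not_mem_range_of_range_eq hrange w) hyp x hx1
          fun h => hx2 (Ideal.mem_sup_left h)
  · intro h2
    obtain ⟨i, hi, j, hj, hij⟩ := Finset.one_lt_card.mp h2
    exact not_isRegularLocalRing_integralClosure_of_two_le_charged (A := V.presheaf.stalk w)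
      (O := V.presheaf.stalk w) (K := V.functionField) (maximalIdeal _) p hp hdegV (S.u w)
      (S.spanFinrank_eq w) (S.span_u w) (S.a w) (S.a_spec w) (S.w w) (S.isUnit_w w) (S.y w)
      (S.y_not_mem_range_of_range_eq hrange w) (S.y_pow_algebraMap hcompat w) hij ((hmemch i).mp hi)
      ((hmemch j).mp hj) (humem i) (humem j)

include hp f hdegV hrange hcompat in
/-- **(B) The normalisation is singular over the generisation `η_𝔮` of `v` iff two distinct
charged coordinates of `v` lie in `𝔮`** (for `v` with at least one charged coordinate; threshold
lemmas with `O = 𝒪_{V,η_𝔮} = (𝒪_{V,v})_𝔮`). [folklore] -/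
theorem not_isRegularLocalRing_fromSpecStalk_iff [LocallyOfFiniteType f] (v : V)
    (hch : ∃ i, S.a v i ≠ 0) (q : PrimeSpectrum (V.presheaf.stalk v)) :
    ¬ IsRegularLocalRing (integralClosure (V.presheaf.stalk (V.fromSpecStalk v q)) L) ↔
      ∃ i j, i ≠ j ∧ S.a v i ≠ 0 ∧ S.a v j ≠ 0 ∧ S.u v i ∈ q.asIdeal ∧ S.u v j ∈ q.asIdeal := by
  classical
  letI := (V.presheaf.stalkSpecializes (fromSpecStalk_specializes q)).hom.toAlgebra
  haveI : CharP V.functionField p := TowerTransport.charP_functionField V f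
  haveI : IsRegularLocalRing (V.presheaf.stalk v) := S.isRegular v
  haveI := isLocalization_generisation v q
  haveI := isScalarTower_generisation_functionField v q
  haveI := isScalarTower_generisation (L := L) v q
  obtain ⟨algk, hess⟩ := exists_algebra_essFiniteType k f v
  constructor
  · intro hnot
    by_contra hno
    push Not at hno
    exact hnot (isRegularLocalRing_integralClosure_of_charged_le_one (A := V.presheaf.stalk v)
      (O := V.presheaf.stalk (V.fromSpecStalk v q)) (K := V.functionField) q.asIdeal p hp hdegV k
      (S.u v) (S.spanFinrank_eq v) (S.span_u v) (S.a v) (S.a_spec v) (S.w v) (S.isUnit_w v) (S.y v)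
      (S.y_not_mem_range_of_range_eq hrange v) (S.y_pow_algebraMap hcompat v) hch
      fun i j hi hj hiq hjq => by_contra fun hij => hno i j hij hi hj hiq hjq)
  · rintro ⟨i, j, hij, hi, hj, hiq, hjq⟩
    exact not_isRegularLocalRing_integralClosure_of_two_le_charged (A := V.presheaf.stalk v)
      (O := V.presheaf.stalk (V.fromSpecStalk v q)) (K := V.functionField) q.asIdeal p hp hdegV
      (S.u v) (S.spanFinrank_eq v) (S.span_u v) (S.a v) (S.a_spec v) (S.w v) (S.isUnit_w v) (S.y v)
      (S.y_not_mem_range_of_range_eq hrange v) (S.y_pow_algebraMap hcompat v) hij hi hj hiq hjq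

end Thresholds

end GameState

end Summit.ResolutionOfSingularities.ResolutionOfSingularities.Theorems.RadicialJung.CleanModelsSuffice

end
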